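import Mathlib
import Summits.ResolutionOfSingularities.ResolutionOfSingularities.Theorems.RadicialJungCleanModelsCleanProp44TauTwoRegime
import Summits.ResolutionOfSingularities.ResolutionOfSingularities.Theorems.RadicialJungCleanModelsCleanPermissibleSeqPoint
import Literature.AlgebraicGeometry.Resolution.PointCentrePermissible
import Literature.AlgebraicGeometry.Resolution.HilbertSamuelSemicontinuityExcellent
import HarnessLib

/-!
# Route `RadicialJung`, crux `CleanModels` (stmt-ResolutionOfSingularities-15917), line `Sketch` rev 35, stub 6 `stub_cleanProp44` (X44c):
# the `τ ≥ 2` regime in STAGE-FREE currency, and the FIRST `τ = 1` CASE — an isolated exception without very near points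

Seat decomp-res-hand-2 g15 (structural hand), continuation of ✓ `…CleanProp44TauTwoRegime.lean` (`cleanProp44_of_two_le_stalkTau`:
X44c in the `τ ≥ 2` regime, stated on the stages `ρ : X → S` of `stub_cleanProp44`).

* `exists_isCleanPermissibleSeq_lt_of_two_le_stalkTau` — **the `τ ≥ 2` regime theorem in the STAGE-FREE currency of the clean slices**
  (`X` integral Noetherian regular quasi-excellent of dimension `≤ 3`, `char K(X) = p`, the line of `G` clean-regular at every point, `(J, μ)`
  with `μ ≥ 1`, `ord ≤ μ`, `V(J)` of codimension `≥ 2`): if every closed threefold point of the `μ`-stratum has `τ ≥ 2`, some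
  CLEAN-permissible sequence brings the order below `μ` everywhere.  (Same proof as the stage version; this is the form the slices and
  clean patching consume, e.g. on opens and on later stages, where `S`-excellence and `dim S = 3` are not available.)
* `exists_isCleanPermissibleSeq_lt_of_two_le_stalkTau_off_point` — **the first `τ = 1` case of X44c: ONE exceptional closed threefold point
  `x₀` of the stratum (any `τ`, e.g. `τ_{x₀} = 1`) WITHOUT VERY NEAR POINTS** — every closed threefold near point of `x₀` under the blowing up
  at `x₀` has `τ ≥ 2` ([CoP1] Prop. 4.2 (b): near points `x'` with `τ(x') = τ(x)` are the «very near» ones) — and `τ ≥ 2` at every other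
  closed threefold point of the stratum: blow up `x₀` (clean-permissible for free, ✓ `IsCleanPermissibleSeq.cons_point`; the blowing up exists,
  ✓ `exists_isBlowup`), after which the stage is in the `τ ≥ 2` regime (near points by hypothesis; all other points by ✓
  `IsBlowup.stalkTau_controlledTransform_of_not_mem`), and conclude by the regime theorem and ✓ `IsCleanPermissibleSeq.comp`.
* `cleanProp44_of_two_le_stalkTau_off_point` — the same on the stages of `stub_cleanProp44` (binders verbatim + the two hypotheses).

So the `τ = 1` residual of stub 6 ((R1)–(R3) of ✓ `cleanProp44_of_tauOneResidual`) begins exactly at the `τ = 1` points that HAVE a very near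
point — the chains of [CoP1] p. 11 / T1 (✓ `CP2008Prop44.stub_T1`) and the births of memo 4e §2.4–2.6.

Honest framing: OURS; nothing here proves X44c in general, any case of `CleanModels`, or resolution of singularities in characteristic `p`.
[cite: CossartPiltant2008, Prop. 4.2 (b), Lemma 4.3, Prop. 4.4 (proof, pp. 9–11)] [cite: Piltant2013, Prop. 5.1 (proof, Step 2)]
-/

noncomputable section

set_option linter.dupNamespace false -- mandated namespace of this single-conjunct summit

open CategoryTheory CategoryTheory.Limits AlgebraicGeometry TopologicalSpace IsLocalRing
open Literature.AlgebraicGeometry.Resolution Literature.AlgebraicGeometry.Motives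
open Scheme.IdealSheafData
open Summit.ResolutionOfSingularities.ResolutionOfSingularities.Theorems.CP2008Prop44

namespace Summit.ResolutionOfSingularities.ResolutionOfSingularities.Theorems.RadicialJung.CleanModels

/-! ## §0 Plumbing -/

/-- For a point with regular local ring: embedding dimension `3` iff coheight `3`. [folklore] -/
private theorem spanFinrank_eq_three_iff_coheight' {X : Scheme.{0}} (x : X) [IsRegularLocalRing (X.presheaf.stalk x)] :
    (maximalIdeal (X.presheaf.stalk x)).spanFinrank = 3 ↔ Order.coheight x = 3 := by
  have h := CampaignW46.coheight_eq_spanFinrank x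
  constructor
  · intro hd
    rw [h, hd]
    rfl
  · intro hc
    rw [hc] at h
    exact_mod_cast h.symm

/-- Two points of coheight `2` one of which specialises to the other are equal. [folklore] -/
private theorem eq_of_specializes_of_coheight_eq_two'' {X : Scheme.{0}} {ζ₁ ζ₂ : X} (h : ζ₁ ⤳ ζ₂)
    (h₁ : Order.coheight ζ₁ = 2) (h₂ : Order.coheight ζ₂ = 2) : ζ₁ = ζ₂ := by
  by_contra hne
  have hlt : ζ₂ < ζ₁ := ⟨h, fun h' => hne (h.antisymm h').eq⟩
  have h3 := Order.coheight_add_one_le hlt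
  rw [h₁, h₂] at h3
  exact absurd h3 (by decide)

/-- In the situation of `exists_isCleanPermissibleSeq_lt_of_pieces`: a point of order `≥ m` lies in `Z i` or outside `V i`. [folklore] -/
private theorem mem_or_not_mem_of_cover'' {X : Scheme.{0}} {J : X.IdealSheafData} {m : ℕ} {n : ℕ} {Z : Fin n → Set X}
    (hcov : ∀ z : X, (m : ℕ∞) ≤ idealOrder J z → ∃ i, z ∈ Z i) (i : Fin n) (V : X.Opens)
    (hV : (V : Set X) = (⋃ j ∈ {j : Fin n | j ≠ i}, Z j)ᶜ) (z : X) (hz : (m : ℕ∞) ≤ idealOrder J z) :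
    z ∈ Z i ∨ z ∉ (V : Set X) := by
  obtain ⟨j, hj⟩ := hcov z hz
  by_cases hji : j = i
  · exact Or.inl (hji ▸ hj)
  · right
    rw [hV, Set.mem_compl_iff, not_not]
    exact Set.mem_iUnion₂.mpr ⟨j, hji, hj⟩

/-- A piece contained in `V i`. [folklore] -/
private theorem subset_of_cover'' {X : Scheme.{0}} {n : ℕ} {Z : Fin n → Set X} (hdisj : ∀ i j, i ≠ j → Disjoint (Z i) (Z j))
    (i : Fin n) (V : X.Opens) (hV : (V : Set X) = (⋃ j ∈ {j : Fin n | j ≠ i}, Z j)ᶜ) : Z i ⊆ (V : Set X) := by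
  intro z hz
  rw [hV, Set.mem_compl_iff, Set.mem_iUnion₂]
  rintro ⟨j, hj, hzj⟩
  exact Set.disjoint_left.mp (hdisj i j (Ne.symm hj)) hz hzj

/-! ## §1 The `τ ≥ 2` regime theorem, stage-free currency -/

set_option maxHeartbeats 1600000 in
-- the piece analysis has five branches (as in `cleanProp44_of_two_le_stalkTau`)
/-- **X44c's conclusion in the `τ ≥ 2` regime, stage-free currency.**  `X` integral Noetherian regular quasi-excellent of dimension `≤ 3`,
`char K(X) = p`, the line of `G` clean-regular at every point; `(J, μ)` with `μ ≥ 1`, `ord ≤ μ`, `V(J)` of codimension `≥ 2`; every closed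
point `x` with `ord_x J = μ` and embedding dimension `3` has `τ_x ≥ 2`.  Then some CLEAN-permissible sequence `π : X' → X` for `(J, μ)` and the
line of `G` has `ord J' < μ` everywhere. [cite: CossartPiltant2008, Prop. 4.4 (proof, pp. 9–11), Lemma 4.3] [cite: Piltant2013, Prop. 5.1 (proof, Step 2)] -/
theorem exists_isCleanPermissibleSeq_lt_of_two_le_stalkTau {p : ℕ} (hp : p.Prime) {X : Scheme.{0}} [IsIntegral X] [IsNoetherian X]
    [hcharX : CharP X.functionField p] (hX : Scheme.IsRegular X) (hqe : Scheme.IsQuasiExcellent X) (hX3 : topologicalKrullDim X ≤ 3)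
    (G : X.functionField) (hG : ∀ x : X, CleanRegAt p (algebraMap (X.presheaf.stalk x) X.functionField) G)
    (J : X.IdealSheafData) {μ : ℕ} (hμ : 1 ≤ μ) (hle : ∀ z, idealOrder J z ≤ μ) (hcodim : ∀ z ∈ J.support, 1 < Order.coheight z)
    (hτ2 : ∀ x : X, IsClosed ({x} : Set X) → idealOrder J x = μ → (maximalIdeal (X.presheaf.stalk x)).spanFinrank = 3 →
      ∀ hr : IsRegularLocalRing (X.presheaf.stalk x), 2 ≤ @stalkTau X J x hr μ) :
    ∃ (X' : Scheme.{0}) (π : X' ⟶ X) (_ : IsIntegral X') (_ : IsDominant π) (J' : X'.IdealSheafData),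
      IsCleanPermissibleSeq p π J μ J' G ∧ ∀ x, idealOrder J' x < μ := by
  -- Phase I (clean, ✓): a stage without bad points
  obtain ⟨X₁, Φ, hint₁', hΦ, J₁, hseq, hRT⟩ := exists_cleanSeq_regular_transverse hp hX hqe hX3 G hG J hμ hle hcodim
  haveI := hint₁'
  haveI := hΦ
  -- the invariants at the reached stage (over the forgetful map to the W4.6 currency)
  have hseqW : CampaignW46.IsPermissibleBlowupSeq J μ Φ J₁ :=
    CP2008Prop44.isPermissibleBlowupSeq_of_isPermissibleSeq hseq.isPermissibleSeq
  obtain ⟨-, hnoeth₁, hX₁, hqe₁, hle₁, hcodim₁⟩ := IsPermissibleBlowupSeq.prop44Invariants hX hqe hμ hle hcodim hseqW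
  haveI := hnoeth₁
  have hX3₁ : topologicalKrullDim X₁ ≤ 3 := hseqW.topologicalKrullDim_le inferInstance hX3
  have hG₁ : ∀ x : X₁, IsGRing (X₁.presheaf.stalk x) := fun x => Scheme.isGRing_stalk_of_isQuasiExcellent hqe₁ x
  haveI hcharX₁ : CharP X₁.functionField p := charP_of_injective_ringHom (RatFn.functionFieldMap Φ).injective p
  have hcoh3 : ∀ z : X₁, Order.coheight z ≤ 3 := (topologicalKrullDim_le_iff_forall_coheight_le X₁ 3).mp hX3₁
  -- the line stays clean-regular at every point of the reached stage
  have hG₁' : ∀ x : X₁, CleanRegAt p (algebraMap (X₁.presheaf.stalk x) X₁.functionField) (RatFn.functionFieldMap Φ G) :=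
    hseq.cleanRegAt hp hcharX hG
  -- THE REGIME PERSISTS at the reached stage
  have hτ2₁ : ∀ x : X₁, IsClosed ({x} : Set X₁) → idealOrder J₁ x = μ → (maximalIdeal (X₁.presheaf.stalk x)).spanFinrank = 3 →
      ∀ hr : IsRegularLocalRing (X₁.presheaf.stalk x), 2 ≤ @stalkTau X₁ J₁ x hr μ :=
    hseq.two_le_stalkTau_of_forall inferInstance hX hqe hX3 hμ hle hcodim hτ2
  -- the stage is TIDY: the curves of `Σ` are regular (no bad point) …
  have htidy_reg : ∀ ζ : X₁, (μ : ℕ∞) ≤ idealOrder J₁ ζ → Order.coheight ζ = 2 → ¬ IsClosed ({ζ} : Set X₁) →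
      Scheme.IsRegular (vanishingIdeal (⟨closure {ζ}, isClosed_closure⟩ : Closeds X₁)).subscheme :=
    fun ζ hζ hcoh hcl => (curve_of_noBad hX₁ hX3₁ J₁ hμ hle₁ hcodim₁ (𝒞 := {C : Closeds X₁ | _}) (fun C => Iff.rfl) hRT
      ⟨ζ, mem_maxPoints_setOf_of_coheight_eq_two hμ hcoh3 hcodim₁ hζ hcoh, hcl, rfl⟩).1
  -- … and pairwise DISJOINT: at most one curve of `Σ` through a `τ ≥ 2` point
  have htidy_disj : ∀ ζ₁ ζ₂ : X₁, (μ : ℕ∞) ≤ idealOrder J₁ ζ₁ → Order.coheight ζ₁ = 2 → ¬ IsClosed ({ζ₁} : Set X₁) →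
      (μ : ℕ∞) ≤ idealOrder J₁ ζ₂ → Order.coheight ζ₂ = 2 → ¬ IsClosed ({ζ₂} : Set X₁) → ζ₁ ≠ ζ₂ →
      Disjoint (closure ({ζ₁} : Set X₁)) (closure {ζ₂}) := by
    intro ζ₁ ζ₂ hζ₁ hc₁ hn₁ hζ₂ hc₂ hn₂ hne
    rw [Set.disjoint_iff]
    rintro q ⟨hq₁, hq₂⟩
    have hmax₁ := mem_maxPoints_setOf_of_coheight_eq_two hμ hcoh3 hcodim₁ hζ₁ hc₁
    have hmax₂ := mem_maxPoints_setOf_of_coheight_eq_two hμ hcoh3 hcodim₁ hζ₂ hc₂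
    obtain ⟨hCreg, -, hCord, hCcurve, hCtr⟩ := curve_of_noBad hX₁ hX3₁ J₁ hμ hle₁ hcodim₁ (𝒞 := {C : Closeds X₁ | _})
      (fun C => Iff.rfl) hRT ⟨ζ₁, hmax₁, hn₁, rfl⟩
    -- the two curves are distinct members of the family of curves of `Σ`
    have hDC : (⟨closure {ζ₂}, isClosed_closure⟩ : Closeds X₁) ≠ ⟨closure {ζ₁}, isClosed_closure⟩ := by
      intro h
      have h' : closure ({ζ₂} : Set X₁) = closure {ζ₁} := congrArg (fun D : Closeds X₁ => (D : Set X₁)) h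
      have h12 : ζ₁ ⤳ ζ₂ := specializes_iff_mem_closure.mpr (h' ▸ subset_closure rfl)
      exact hne (eq_of_specializes_of_coheight_eq_two'' h12 hc₁ hc₂)
    obtain ⟨-, hdim3⟩ := hCtr _ ⟨ζ₂, hmax₂, hn₂, rfl⟩ hDC q ⟨hq₁, hq₂⟩
    -- `q` is a closed threefold point of the stratum, so `τ_q ≥ 2`
    haveI hrq : IsRegularLocalRing (X₁.presheaf.stalk q) := hX₁ q
    have hdq : (maximalIdeal (X₁.presheaf.stalk q)).spanFinrank = 3 := by
      have h1 := IsRegularLocalRing.spanFinrank_maximalIdeal (R := X₁.presheaf.stalk q)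
      rw [hdim3] at h1
      exact_mod_cast h1
    have hcohq : Order.coheight q = 3 := (spanFinrank_eq_three_iff_coheight' q).mp hdq
    have hqcl : IsClosed ({q} : Set X₁) := isClosed_singleton_of_coheight_eq_three hcoh3 hcohq
    have hτq : 2 ≤ stalkTau J₁ q μ := hτ2₁ q hqcl (hCord q hq₁) hdq hrq
    obtain ⟨c, hcr, hcY⟩ := hCcurve q hq₁ hrq
    exact hne (eq_of_two_le_stalkTau_of_mem_closure hX₁ hqe₁ J₁ hμ hle₁ hcodim₁ hζ₁ hc₁ hζ₂ hc₂ hCreg hq₂ hcr hcY hτq)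
  -- the pieces of the tidy stage (✓)
  obtain ⟨n, Z, hZc, hdisj, hcov, hkind⟩ := exists_pieces_of_tidy hX₁ hqe₁ hX3₁ J₁ hμ hle₁ hcodim₁ htidy_reg htidy_disj
  -- settle each piece relative to the complement of the others, and patch
  have hred : ∃ (X' : Scheme.{0}) (π : X' ⟶ X₁) (_ : IsIntegral X') (_ : IsDominant π) (J' : X'.IdealSheafData),
      IsCleanPermissibleSeq p π J₁ μ J' (RatFn.functionFieldMap Φ G) ∧ ∀ x, idealOrder J' x < μ := by
    refine exists_isCleanPermissibleSeq_lt_of_pieces J₁ μ (RatFn.functionFieldMap Φ G) Z hZc hdisj hcov fun i V hV => ?_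
    intro hVint hVdom
    have hbad := mem_or_not_mem_of_cover'' hcov i V hV
    have hZV := subset_of_cover'' hdisj i V hV
    rcases hkind i with ⟨x, hZ, hord, hdim, hτ⟩ | ⟨x, hZ, hord, hdim, hτ⟩ | ⟨x, hZ, hord, hcoh⟩ | ⟨Y, hZ, hreg, hirr, hordY, hcurveY⟩
    · -- τ ≥ 2 threefold point: the CLEAN isolated τ ≥ 2 slice (✓ `…CleanTauTwoSlice`)
      have hxV : x ∈ V := hZV (by rw [hZ]; exact Set.mem_singleton x)
      have hcl : IsClosed ({x} : Set X₁) := hZ ▸ hZc i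
      exact exists_isCleanPermissibleSeq_lt_comap_of_isolated_two_le_tau hp hX₁ J₁ hμ (RatFn.functionFieldMap Φ G) hG₁' V x hxV hcl
        (fun z hz => (hbad z hz).imp (fun h => by rw [hZ] at h; exact h) id) hord hdim (hτ (hX₁ x)) (hG₁ x)
    · -- τ = 1 threefold point: EXCLUDED by the regime
      exfalso
      have hcl : IsClosed ({x} : Set X₁) := hZ ▸ hZc i
      have h2 := hτ2₁ x hcl hord hdim (hX₁ x)
      have h1 := hτ (hX₁ x)
      omega
    · -- coheight-2 point: the CLEAN local-dimension-two slice (✓ `…CleanDimTwoSlice`)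
      have hxV : x ∈ V := hZV (by rw [hZ]; exact Set.mem_singleton x)
      have hcl : IsClosed ({x} : Set X₁) := hZ ▸ hZc i
      exact exists_isCleanPermissibleSeq_lt_comap_of_isolated_coheight_two hp hX₁ J₁ hμ hle₁ hcodim₁ (RatFn.functionFieldMap Φ G) hG₁'
        V x hxV hcl (fun z hz => (hbad z hz).imp (fun h => by rw [hZ] at h; exact h) id) hord hcoh
    · -- regular irreducible piece `Y` of the stratum: its generic point `η`
      obtain ⟨η, hη⟩ := QuasiSober.sober hirr Y.isClosed
      have hYeq : (Y : Set X₁) = closure {η} := (isGenericPoint_def.mp hη).symm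
      have hηY : η ∈ (Y : Set X₁) := hη.mem
      have hordη : idealOrder J₁ η = μ := hordY η hηY
      have hηsupp : η ∈ J₁.support := by
        rw [← one_le_idealOrder_iff, hordη]
        exact_mod_cast hμ
      have h1η : 1 < Order.coheight η := hcodim₁ η hηsupp
      by_cases hηcl : IsClosed ({η} : Set X₁)
      · -- degenerate piece `Y = {η}`: a single closed point
        have hYpt : (Y : Set X₁) = {η} := by rw [hYeq, hηcl.closure_eq]
        have hηV : η ∈ V := hZV (by rw [hZ]; exact hηY)
        have hbad' : ∀ z : X₁, (μ : ℕ∞) ≤ idealOrder J₁ z → z = η ∨ z ∉ (V : Set X₁) :=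
          fun z hz => (hbad z hz).imp (fun h => by rw [hZ, hYpt] at h; exact h) id
        by_cases hcohη : Order.coheight η = 3
        · -- a threefold point, `τ ≥ 2` by the regime: the clean isolated τ ≥ 2 slice
          haveI hrη : IsRegularLocalRing (X₁.presheaf.stalk η) := hX₁ η
          have hdη : (maximalIdeal (X₁.presheaf.stalk η)).spanFinrank = 3 := (spanFinrank_eq_three_iff_coheight' η).mpr hcohη
          exact exists_isCleanPermissibleSeq_lt_comap_of_isolated_two_le_tau hp hX₁ J₁ hμ (RatFn.functionFieldMap Φ G) hG₁' V η hηV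
            hηcl hbad' hordη hdη (hτ2₁ η hηcl hordη hdη (hX₁ η)) (hG₁ η)
        · -- a coheight-2 point: the clean local-dimension-two slice
          have hcoh2 : Order.coheight η = 2 := by
            have h3 := hcoh3 η
            generalize hc : Order.coheight η = c at h1η h3 hcohη
            induction c using ENat.recTopCoe with
            | top => exact absurd h3 (by simp)
            | coe m =>
              have h1' : 1 < m := by exact_mod_cast h1η
              have h3' : m ≤ 3 := by exact_mod_cast h3
              have hne3 : m ≠ 3 := fun h => hcohη (by rw [h]; rfl)
              have : m = 2 := by omega
              rw [this]
              rfl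
          exact exists_isCleanPermissibleSeq_lt_comap_of_isolated_coheight_two hp hX₁ J₁ hμ hle₁ hcodim₁ (RatFn.functionFieldMap Φ G)
            hG₁' V η hηV hηcl hbad' hordη hcoh2
      · -- a genuine curve: its closed points are threefold points of the stratum, `τ ≥ 2` there by the regime: the clean τ ≥ 2 curve slice
        have hall : ∀ y ∈ (Y : Set X₁), IsClosed ({y} : Set X₁) → haveI := hX₁ y; 2 ≤ stalkTau J₁ y μ := by
          intro y hy hycl
          have hηy : η ⤳ y := specializes_iff_mem_closure.mpr (hYeq ▸ hy)
          have hyη : ¬ y ⤳ η := fun h' => hηcl (by rw [(hηy.antisymm h').eq]; exact hycl)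
          obtain ⟨-, hcohy⟩ := coheight_eq_two_of_specializes hηy hyη h1η (hcoh3 y)
          haveI hry : IsRegularLocalRing (X₁.presheaf.stalk y) := hX₁ y
          have hdy : (maximalIdeal (X₁.presheaf.stalk y)).spanFinrank = 3 := (spanFinrank_eq_three_iff_coheight' y).mpr hcohy
          exact hτ2₁ y hycl (hordY y hy) hdy (hX₁ y)
        exact exists_isCleanPermissibleSeq_lt_comap_of_curve_two_le_tau hp hX₁ hqe₁ hX3₁ (RatFn.functionFieldMap Φ G) hG₁' J₁ hμ hle₁ V Y hirr
          (hZ ▸ hZV) (fun z hz => (hbad z hz).imp (fun h => by rw [hZ] at h; exact h) id) hordY (fun y hy => hcurveY y hy (hX₁ y)) hall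
  -- compose with the Phase I sequence
  obtain ⟨X', π, hX', hπ, J', hseq', hlt⟩ := hred
  haveI := hX'
  haveI := hπ
  exact ⟨X', π ≫ Φ, inferInstance, inferInstance, J', hseq.comp hseq' rfl, hlt⟩

/-! ## §2 The first `τ = 1` case: one exceptional point without very near points -/

set_option maxHeartbeats 800000 in
-- near-point bookkeeping at the new stage
/-- **X44c's conclusion when the `μ`-stratum has ONE exceptional closed threefold point `x₀` WITHOUT VERY NEAR POINTS and `τ ≥ 2` at every
other closed threefold point** (stage-free currency).  The hypothesis `hvn` says: for every blowing up `π₁ : X₁ → X` of the (reduced) closed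
point `x₀`, every CLOSED near point `x'` of `x₀` (`ord_{x'} J₁ = μ` for the controlled transform `J₁`) of embedding dimension `3` has
`τ_{x'}(J₁, μ) ≥ 2` — by [CoP1] Prop. 4.2 (b) (`τ(x') ≥ τ(x)` at near points, «very near» iff equality) this is «`x₀` has no very near point»
when `τ_{x₀} = 1`.  Proof: blow up `x₀` (✓ `exists_isBlowup`, clean-permissible ✓ `IsCleanPermissibleSeq.cons_point`); the new stage is in the
`τ ≥ 2` regime (over `x₀` by `hvn`, elsewhere the local rings are unchanged); apply `exists_isCleanPermissibleSeq_lt_of_two_le_stalkTau` and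
compose. [cite: CossartPiltant2008, Prop. 4.2 (b), Lemma 4.3, Prop. 4.4 (proof, p. 11)] -/
theorem exists_isCleanPermissibleSeq_lt_of_two_le_stalkTau_off_point {p : ℕ} (hp : p.Prime) {X : Scheme.{0}} [IsIntegral X]
    [IsNoetherian X] [hcharX : CharP X.functionField p] (hX : Scheme.IsRegular X) (hqe : Scheme.IsQuasiExcellent X)
    (hX3 : topologicalKrullDim X ≤ 3) (G : X.functionField)
    (hG : ∀ x : X, CleanRegAt p (algebraMap (X.presheaf.stalk x) X.functionField) G)
    (J : X.IdealSheafData) {μ : ℕ} (hμ : 1 ≤ μ) (hle : ∀ z, idealOrder J z ≤ μ) (hcodim : ∀ z ∈ J.support, 1 < Order.coheight z)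
    (x₀ : X) (hx₀ : IsClosed ({x₀} : Set X)) (hord₀ : idealOrder J x₀ = μ)
    (hvn : ∀ (X₁ : Scheme.{0}) (π₁ : X₁ ⟶ X), IsBlowup π₁ (vanishingIdeal ⟨{x₀}, hx₀⟩) →
      ∀ x' : X₁, IsClosed ({x'} : Set X₁) → π₁ x' = x₀ →
        idealOrder (controlledTransform π₁ (vanishingIdeal ⟨{x₀}, hx₀⟩) J μ) x' = μ →
        (maximalIdeal (X₁.presheaf.stalk x')).spanFinrank = 3 →
        ∀ hr : IsRegularLocalRing (X₁.presheaf.stalk x'),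
          2 ≤ @stalkTau X₁ (controlledTransform π₁ (vanishingIdeal ⟨{x₀}, hx₀⟩) J μ) x' hr μ)
    (hτ2 : ∀ x : X, x ≠ x₀ → IsClosed ({x} : Set X) → idealOrder J x = μ → (maximalIdeal (X.presheaf.stalk x)).spanFinrank = 3 →
      ∀ hr : IsRegularLocalRing (X.presheaf.stalk x), 2 ≤ @stalkTau X J x hr μ) :
    ∃ (X' : Scheme.{0}) (π : X' ⟶ X) (_ : IsIntegral X') (_ : IsDominant π) (J' : X'.IdealSheafData),
      IsCleanPermissibleSeq p π J μ J' G ∧ ∀ x, idealOrder J' x < μ := by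
  -- the blowing up of the closed point `x₀`
  set Y₀ : Closeds X := ⟨{x₀}, hx₀⟩ with hY₀def
  obtain ⟨X₁, π₁, hπ₁⟩ := exists_isBlowup X (vanishingIdeal Y₀)
  have hY₀ord : ∀ y ∈ (Y₀ : Set X), idealOrder J y = μ := forall_mem_closeds_singleton_idealOrder_eq hx₀ hord₀
  have hJne : J ≠ ⊥ := ne_bot_of_forall_one_lt_coheight hcodim
  have hY₀ne : vanishingIdeal Y₀ ≠ ⊥ := vanishingIdeal_ne_bot_of_forall_idealOrder_eq hJne hμ hY₀ord
  haveI : IsIntegral X₁ := hπ₁.isIntegral hY₀ne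
  haveI : IsDominant π₁ := isDominant_of_isBlowup_of_ne_bot hπ₁ hY₀ne
  haveI : IsProper π₁ := hπ₁.isProper
  haveI : IsLocallyNoetherian X₁ := hπ₁.isLocallyNoetherian
  have hY₀reg : Scheme.IsRegular (vanishingIdeal Y₀).subscheme := isRegular_subscheme_vanishingIdeal_singleton hx₀
  have hY₀int : IsIntegral (vanishingIdeal Y₀).subscheme := isIntegral_subscheme_vanishingIdeal_singleton hx₀
  -- the one-step clean-permissible sequence
  have hseq₁ : IsCleanPermissibleSeq p (π₁ ≫ 𝟙 X) J μ (controlledTransform π₁ (vanishingIdeal Y₀) J μ) G :=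
    IsCleanPermissibleSeq.cons_point hp π₁ (𝟙 X) J μ J G (IsCleanPermissibleSeq.nil J μ G) x₀ hx₀ hY₀int hY₀reg hord₀ hπ₁
      (by rw [RatFn.functionFieldMap_id]; exact hG x₀)
  have hseq₁' : IsCleanPermissibleSeq p π₁ J μ (controlledTransform π₁ (vanishingIdeal Y₀) J μ) G := by
    simpa only [Category.comp_id] using hseq₁
  set J₁ := controlledTransform π₁ (vanishingIdeal Y₀) J μ with hJ₁def
  -- the invariants at the new stage
  have hseqW : CampaignW46.IsPermissibleBlowupSeq J μ π₁ J₁ :=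
    CP2008Prop44.isPermissibleBlowupSeq_of_isPermissibleSeq hseq₁'.isPermissibleSeq
  obtain ⟨-, hnoeth₁, hX₁, hqe₁, hle₁, hcodim₁⟩ := IsPermissibleBlowupSeq.prop44Invariants hX hqe hμ hle hcodim hseqW
  haveI := hnoeth₁
  have hX3₁ : topologicalKrullDim X₁ ≤ 3 := hseqW.topologicalKrullDim_le inferInstance hX3
  have hcoh3₁ : ∀ z : X₁, Order.coheight z ≤ 3 := (topologicalKrullDim_le_iff_forall_coheight_le X₁ 3).mp hX3₁
  haveI hcharX₁ : CharP X₁.functionField p := charP_of_injective_ringHom (RatFn.functionFieldMap π₁).injective p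
  have hG₁ : ∀ x : X₁, CleanRegAt p (algebraMap (X₁.presheaf.stalk x) X₁.functionField) (RatFn.functionFieldMap π₁ G) :=
    hseq₁'.cleanRegAt hp hcharX hG
  -- the new stage is in the `τ ≥ 2` regime
  have hτ2₁ : ∀ x' : X₁, IsClosed ({x'} : Set X₁) → idealOrder J₁ x' = μ → (maximalIdeal (X₁.presheaf.stalk x')).spanFinrank = 3 →
      ∀ hr : IsRegularLocalRing (X₁.presheaf.stalk x'), 2 ≤ @stalkTau X₁ J₁ x' hr μ := by
    intro x' hx'cl hord' hd' hr'
    by_cases hover : π₁ x' = x₀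
    · -- a near point of `x₀`: hypothesis `hvn`
      exact hvn X₁ π₁ hπ₁ x' hx'cl hover hord' hd' hr'
    · -- off the centre: the local ring, the order and `τ` are those of the image point
      haveI hry : IsRegularLocalRing (X.presheaf.stalk (π₁ x')) := hX (π₁ x')
      have hycl : IsClosed ({π₁ x'} : Set X) := by
        have := π₁.isClosedMap _ hx'cl
        rwa [Set.image_singleton] at this
      have hcohx' : Order.coheight x' = 3 := (spanFinrank_eq_three_iff_coheight' x').mp hd'
      have hcoh3 : ∀ z : X, Order.coheight z ≤ 3 := (topologicalKrullDim_le_iff_forall_coheight_le X 3).mp hX3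
      have hcohy : Order.coheight (π₁ x') = 3 := le_antisymm (hcoh3 _) (hcohx' ▸ hπ₁.coheight_le x')
      have hdy : (maximalIdeal (X.presheaf.stalk (π₁ x'))).spanFinrank = 3 := (spanFinrank_eq_three_iff_coheight' _).mpr hcohy
      have hnot : π₁ x' ∉ ((vanishingIdeal Y₀).support : Set X) := by
        rw [Scheme.IdealSheafData.coe_support_vanishingIdeal]
        exact hover
      have hτeq := hπ₁.stalkTau_controlledTransform_of_not_mem J μ μ hnot (x' := x')
      have hordeq := hπ₁.idealOrder_controlledTransform_of_not_mem J μ hnot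
      rw [hJ₁def, hτeq]
      rw [hJ₁def, hordeq] at hord'
      exact hτ2 (π₁ x') hover hycl hord' hdy hry
  -- the regime theorem at the new stage, composed with the first blowing up
  obtain ⟨X', π', hX', hπ', J', hseq', hlt⟩ :=
    exists_isCleanPermissibleSeq_lt_of_two_le_stalkTau hp hX₁ hqe₁ hX3₁ (RatFn.functionFieldMap π₁ G) hG₁ J₁ hμ hle₁ hcodim₁ hτ2₁
  haveI := hX'
  haveI := hπ'
  exact ⟨X', π' ≫ π₁, inferInstance, inferInstance, J', hseq₁'.comp hseq' rfl, hlt⟩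

/-! ## §3 The same on the stages of `stub_cleanProp44` -/

set_option maxHeartbeats 800000 in
-- long binder list
/-- **X44c (`stub_cleanProp44`) with ONE exceptional point without very near points.**  The binders of `stub_cleanProp44` VERBATIM, plus: a
closed point `x₀` of the stage with `ord_{x₀} J = μ` having no very near point (hypothesis `hvn` of
`exists_isCleanPermissibleSeq_lt_of_two_le_stalkTau_off_point`), and `τ ≥ 2` at every other closed threefold point of the `μ`-stratum.
Conclusion: the conclusion of `stub_cleanProp44` verbatim. [cite: CossartPiltant2008, Prop. 4.2 (b), Prop. 4.4] -/
theorem cleanProp44_of_two_le_stalkTau_off_point :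
    ∀ (p : ℕ), p.Prime → ∀ (S : Scheme.{0}) [IsIntegral S] [IsNoetherian S],
      CharP S.functionField p → Scheme.IsRegular S → Scheme.IsExcellent S → topologicalKrullDim S = 3 →
      ∀ G₀ : S.functionField, (∀ s : S, CleanRegAt p (algebraMap (S.presheaf.stalk s) S.functionField) G₀) →
      ∀ I : S.IdealSheafData, I ≠ ⊥ →
      ∀ (X : Scheme.{0}) (ρ : X ⟶ S) [IsIntegral X] [IsNoetherian X] [IsDominant ρ],
        IsCleanRegularCentreBlowupSeq p ρ I G₀ →
        (∀ x : X, CleanRegAt p (algebraMap (X.presheaf.stalk x) X.functionField) (RatFn.functionFieldMap ρ G₀)) →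
        ∀ (J : X.IdealSheafData) (μ : ℕ), 1 ≤ μ →
          (∀ x ∈ J.support, 1 < Order.coheight x) → (∀ x, idealOrder J x ≤ μ) → (∃ x, idealOrder J x = μ) →
          ∀ (x₀ : X) (hx₀ : IsClosed ({x₀} : Set X)), idealOrder J x₀ = μ →
          (∀ (X₁ : Scheme.{0}) (π₁ : X₁ ⟶ X), IsBlowup π₁ (vanishingIdeal ⟨{x₀}, hx₀⟩) →
            ∀ x' : X₁, IsClosed ({x'} : Set X₁) → π₁ x' = x₀ →
              idealOrder (controlledTransform π₁ (vanishingIdeal ⟨{x₀}, hx₀⟩) J μ) x' = μ →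
              (maximalIdeal (X₁.presheaf.stalk x')).spanFinrank = 3 →
              ∀ hr : IsRegularLocalRing (X₁.presheaf.stalk x'),
                2 ≤ @stalkTau X₁ (controlledTransform π₁ (vanishingIdeal ⟨{x₀}, hx₀⟩) J μ) x' hr μ) →
          (∀ x : X, x ≠ x₀ → IsClosed ({x} : Set X) → idealOrder J x = μ → (maximalIdeal (X.presheaf.stalk x)).spanFinrank = 3 →
            ∀ hr : IsRegularLocalRing (X.presheaf.stalk x), 2 ≤ @stalkTau X J x hr μ) →
          ∃ (X' : Scheme.{0}) (π : X' ⟶ X) (_ : IsIntegral X') (_ : IsDominant π) (J' : X'.IdealSheafData),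
            IsCleanPermissibleSeq p π J μ J' (RatFn.functionFieldMap ρ G₀) ∧ ∀ x, idealOrder J' x < μ := by
  intro p hp S _ _ hchar hS hexc hdimS G₀ _ I _ X ρ _ _ _ hρ hG J μ hμ hcodim hle _ x₀ hx₀ hord₀ hvn hτ2
  have hρ' : IsRegularCentreBlowupSeq ρ I := hρ.isRegularCentreBlowupSeq
  have hX : Scheme.IsRegular X := hρ'.isRegular hS
  have hqe : Scheme.IsQuasiExcellent X := hρ'.isQuasiExcellent hexc
  have hX3 : topologicalKrullDim X ≤ 3 := CP2008Prop44.topologicalKrullDim_stage_le hρ' inferInstance (n := 3) hdimS.le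
  haveI hcharX : CharP X.functionField p := charP_of_injective_ringHom (RatFn.functionFieldMap ρ).injective p
  exact exists_isCleanPermissibleSeq_lt_of_two_le_stalkTau_off_point hp hX hqe hX3 (RatFn.functionFieldMap ρ G₀) hG J hμ hle hcodim
    x₀ hx₀ hord₀ hvn hτ2

end Summit.ResolutionOfSingularities.ResolutionOfSingularities.Theorems.RadicialJung.CleanModels

end
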